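import Mathlib
import Summits.NavierStokesRegularity.NavierStokesRegularity.Theorems.EulerZoomLiouvillePowerGaugeEulerLiouvilleCondenserSharpPacking
import Summits.NavierStokesRegularity.NavierStokesRegularity.Theorems.EulerZoomLiouvillePowerGaugeEulerLiouvilleCondenserSharpGaugeForm

/-!
# THEOREM P — THE PACKING MULTIPLIER (plate t47-P, nsreg-p2 g35 ROUND-45 §3/§6, `r45/Sketch45.lean`
`NsregP2.R45.PackingMultiplier`)

Width piece for crux `EulerZoomLiouville.PowerGaugeEulerLiouville` (stmt-NavierStokesRegularity-19832), by name under
LEAD 19832 (ns-typeII-p2 g13); seat ns-sfl-p1 g6, `--supports stmt-NavierStokesRegularity-19832 --as helper`.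

* **`packingMultiplier`** — THEOREM P, the Sketch45 text VERBATIM: in the setting of THEOREM B′ with a fixed unit direction
  `e` and `1 < Λ' ≤ Λ`, `N ≥ 1` backward orbit segments from `B(0,R)`, inside `B̄(0,ΛR)`, reaching the cap `⟪·,e⟫ ≥ Λ'R`
  and `2r`-separated at equal heights `≥ R`, for ANY disc radius `r ∈ [c₀R^{−(1+ρ)}, R/2]`, force
  `‖DV‖ ≥ exp(κ'R^{2+ρ})` on `B(0,(Λ+1)R)` for every `κ' < N·2πγ²(Λ'³−1)/(3(Λ+1)^{1−ρ}C_E)`: THE EXPONENT IS MULTIPLIED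
  BY THE NUMBER OF SEPARATED SEGMENTS, and does not see `r` down to `r ≍ R^{−(1+ρ)}`;
* the margin arithmetic: `exists_loss_parameter_packing`, `rpow_packing_identity`, `packing_amplitude_le` (the floor
  `c₀R^{−(1+ρ)}` on `r`, `c₀ = √(2C_A(Λ+1)^{1−2ρ}/(πt³γ²(Λ'−1)))`, is exactly what keeps the outer mean
  `√(2A/π)/r ≤ tγR`: amplitude² × height / radius² = `R^{−2ρ}·R^{2+2ρ} = R²`), `packing_exp_absurd`.

Assembly: `Condenser.exists_slice_packing_alternative_of_segments` (first hits of one weighted quiet plane, one `ℂ`-chart,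
one scalar, t47-P₀ `Condenser.circleMeanCondenserPacking`) at the loss parameter `t`, then the two alternatives of the
packed core contradict the envelope `‖DV‖ < exp(κ'R^{2+ρ})` for `R ≥ R₁ = max(1, |log(2tγ)|/(Nκ₁−κ')+1)`
(`Condenser.sharp_drop_absurd`, `packing_exp_absurd`, `Condenser.sharpExponent_identity` × `N`).
READING (ROUND-45 §3, COROLLARY V): finite type `c′` allows at most `(c′/κ⋆)(1+o(1))` separated funnels per direction
cone — «type/κ⋆ counts funnels».
HONEST FRAMING: real analysis in `ℝ³` (with a cut-off flow); nothing here proves the crux E (19832 OPEN), any door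
Target, or any Navier–Stokes statement; no summit statement is touched. [nsreg-p2 ROUND-45 THEOREM P; folklore
(length–area method, additivity of capacity); cite: ConstantinIgnatovaVicol2026Putative, §3.4.1 for the setting]
-/

noncomputable section

open Set Filter Topology Metric Function MeasureTheory Real
open scoped RealInnerProductSpace

set_option linter.dupNamespace false

namespace Summit.NavierStokesRegularity.NavierStokesRegularity.Theorems.PowerGaugeEulerLiouville.Condenser

open Literature.Analysis Literature.Analysis.FluidPDE

/-! ## The margin arithmetic of THEOREM P -/

/-- Choice of the loss parameter for the packed exponent: `f(t) = N·2π(1−2t)²γ²((1+(1−t)(Λ'−1))³−1)/(3C_E(Λ+1)^{1−ρ})`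
is continuous with `f(0) = N·κ_B(Λ,Λ')`, so some `t ∈ (0, 1/4]` still has `f(t) > κ'`. [folklore] -/
theorem exists_loss_parameter_packing {γ ρ C_E Λ Λ' κ' : ℝ} {N : ℕ}
    (hκ : κ' < N * (2 * Real.pi * γ ^ 2 * (Λ' ^ 3 - 1) / (3 * (Λ + 1) ^ (1 - ρ) * C_E))) :
    ∃ t : ℝ, 0 < t ∧ t ≤ 1 / 4 ∧
      κ' < N * (2 * Real.pi * (1 - 2 * t) ^ 2 * γ ^ 2 * ((1 + (1 - t) * (Λ' - 1)) ^ 3 - 1) /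
        (3 * C_E * (Λ + 1) ^ (1 - ρ))) := by
  set f : ℝ → ℝ := fun t => N * (2 * Real.pi * (1 - 2 * t) ^ 2 * γ ^ 2 * ((1 + (1 - t) * (Λ' - 1)) ^ 3 - 1) /
    (3 * C_E * (Λ + 1) ^ (1 - ρ))) with hf
  have hfc : Continuous f := by
    simp only [hf]
    fun_prop
  have hf0 : f 0 = N * (2 * Real.pi * γ ^ 2 * (Λ' ^ 3 - 1) / (3 * (Λ + 1) ^ (1 - ρ) * C_E)) := by
    simp only [hf]; ring
  have hev : ∀ᶠ t in 𝓝 (0 : ℝ), κ' < f t := hfc.continuousAt.eventually (lt_mem_nhds (by rw [hf0]; exact hκ))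
  obtain ⟨ε, hε, hball⟩ := Metric.eventually_nhds_iff.1 hev
  refine ⟨min (ε / 2) (1 / 4), by positivity, min_le_right _ _, ?_⟩
  have h := hball (y := min (ε / 2) (1 / 4)) (by
    rw [Real.dist_eq, sub_zero, abs_of_pos (by positivity)]
    exact (min_le_left _ _).trans_lt (by linarith))
  simpa only [hf] using h

/-- Power bookkeeping: `R² · (R^{−(1+ρ)})² = R^{1−2ρ}/R` for `R > 0`. [folklore] -/
theorem rpow_packing_identity {R ρ : ℝ} (hR : 0 < R) :
    R ^ 2 * (R ^ (-(1 + ρ))) ^ 2 = R ^ (1 - 2 * ρ) / R := by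
  rw [eq_div_iff hR.ne', sq (R ^ (-(1 + ρ))), ← Real.rpow_add hR]
  have h1 : R ^ 2 * R ^ (-(1 + ρ) + -(1 + ρ)) * R = R ^ (3 : ℕ) * R ^ (-(1 + ρ) + -(1 + ρ)) := by ring
  rw [h1, ← Real.rpow_natCast R 3, ← Real.rpow_add hR]
  congr 1
  push_cast
  ring

/-- Amplitude bookkeeping for THEOREM P: with `X = C_A((Λ+1)R)^{1−2ρ}`, `A = X/(t(Λ'−1)R)` and disc radius
`r ≥ c₀R^{−(1+ρ)}`, `c₀ = √(2C_A(Λ+1)^{1−2ρ}/(πt³γ²(Λ'−1)))`, the outer-mean term `√(2A/π)/r` is at most `tγR`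
(the powers of `R` cancel exactly: amplitude² × height / radius² = `R^{−2ρ}·R^{2+2ρ} = R²`). [folklore] -/
theorem packing_amplitude_le {C_A Λ Λ' t γ ρ R r : ℝ} (hCA : 0 < C_A) (hΛ1 : 0 < Λ + 1) (hΛ' : 1 < Λ') (ht : 0 < t)
    (hγ : 0 < γ) (hR : 0 < R)
    (hr : Real.sqrt (2 * C_A * (Λ + 1) ^ (1 - 2 * ρ) / (Real.pi * t ^ 3 * γ ^ 2 * (Λ' - 1))) * R ^ (-(1 + ρ)) ≤ r) :
    Real.sqrt (2 * (C_A * ((Λ + 1) * R) ^ (1 - 2 * ρ) / (t * (Λ' - 1) * R)) / Real.pi) / r ≤ t * γ * R := by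
  have hπ : 0 < Real.pi := Real.pi_pos
  have hΛm : 0 < Λ' - 1 := by linarith
  have hL : 0 < (Λ + 1) ^ (1 - 2 * ρ) := Real.rpow_pos_of_pos hΛ1 _
  have hRp : 0 < R ^ (-(1 + ρ)) := Real.rpow_pos_of_pos hR _
  have hc0 : 0 < Real.sqrt (2 * C_A * (Λ + 1) ^ (1 - 2 * ρ) / (Real.pi * t ^ 3 * γ ^ 2 * (Λ' - 1))) :=
    Real.sqrt_pos.2 (by positivity)
  have hr0 : 0 < r := lt_of_lt_of_le (mul_pos hc0 hRp) hr
  -- it suffices to compare squares: `2A/π ≤ (tγR·r)²`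
  rw [div_le_iff₀ hr0]
  have hB0 : 0 ≤ 2 * (C_A * ((Λ + 1) * R) ^ (1 - 2 * ρ) / (t * (Λ' - 1) * R)) / Real.pi := by positivity
  have htarget : 0 ≤ t * γ * R * r := by positivity
  rw [← Real.sqrt_sq htarget]
  refine Real.sqrt_le_sqrt ?_
  -- the square of the lower bound for `r`
  have hr2 : 2 * C_A * (Λ + 1) ^ (1 - 2 * ρ) / (Real.pi * t ^ 3 * γ ^ 2 * (Λ' - 1)) * (R ^ (-(1 + ρ))) ^ 2 ≤ r ^ 2 := by
    have h := pow_le_pow_left₀ (mul_pos hc0 hRp).le hr 2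
    rwa [mul_pow, Real.sq_sqrt (by positivity)] at h
  have hsplit : ((Λ + 1) * R) ^ (1 - 2 * ρ) = (Λ + 1) ^ (1 - 2 * ρ) * R ^ (1 - 2 * ρ) := Real.mul_rpow hΛ1.le hR.le
  have hid := rpow_packing_identity (ρ := ρ) hR
  -- `2A/π = (2C_A(Λ+1)^{1−2ρ}/(πt(Λ'−1))) · R^{1−2ρ}/R`
  have hAeq : 2 * (C_A * ((Λ + 1) * R) ^ (1 - 2 * ρ) / (t * (Λ' - 1) * R)) / Real.pi =
      2 * C_A * (Λ + 1) ^ (1 - 2 * ρ) / (Real.pi * t * (Λ' - 1)) * (R ^ (1 - 2 * ρ) / R) := by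
    rw [hsplit]; field_simp
  rw [hAeq, ← hid]
  -- compare with `(tγRr)² ≥ t²γ²R² · c₀² R^{−2(1+ρ)}`
  have hkey : (t * γ * R * r) ^ 2 = t ^ 2 * γ ^ 2 * R ^ 2 * r ^ 2 := by ring
  rw [hkey]
  have h3 : 2 * C_A * (Λ + 1) ^ (1 - 2 * ρ) / (Real.pi * t * (Λ' - 1)) * (R ^ 2 * (R ^ (-(1 + ρ))) ^ 2) =
      t ^ 2 * γ ^ 2 * R ^ 2 *
        (2 * C_A * (Λ + 1) ^ (1 - 2 * ρ) / (Real.pi * t ^ 3 * γ ^ 2 * (Λ' - 1)) * (R ^ (-(1 + ρ))) ^ 2) := by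
    field_simp
  rw [h3]
  exact mul_le_mul_of_nonneg_left hr2 (by positivity)

/-- The exponential alternative of the packed core contradicts the gradient envelope `exp(κ' R^{2+ρ})` once
`κ_N = N κ₁ > κ'`, `R ≥ |log(2tγ)|/(κ_N − κ') + 1`, `r ≤ R/2 ≤ s/2` and `R ≤ P = R^{2+ρ}`
(`κ_N P E_s = N·2π(1−2t)²γ²s²`). [folklore] -/
theorem packing_exp_absurd {κN κ' t γ s R r a Es P : ℝ} {N : ℕ} (hgap : κ' < κN) (ht : 0 < t) (ht4 : t ≤ 1 / 4)
    (hγ : 0 < γ) (hR : 0 < R) (hsR : R ≤ s) (hr0 : 0 < r) (hr2 : r ≤ R / 2) (haS : a ≤ t * (γ * s)) (hEs : 0 < Es)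
    (hP : R ≤ P) (hid : κN * P * Es = N * (2 * Real.pi * (1 - 2 * t) ^ 2 * γ ^ 2 * s ^ 2))
    (hRb : |Real.log (2 * t * γ)| / (κN - κ') + 1 ≤ R)
    (h : t * (γ * s) / r * Real.exp (N * (2 * Real.pi * ((1 - t) * (γ * s) - a) ^ 2) / Es) ≤ Real.exp (κ' * P)) :
    False := by
  have hπ : 0 < Real.pi := Real.pi_pos
  have hgap' : 0 < κN - κ' := sub_pos.2 hgap
  have hspos : 0 < s := hR.trans_le hsR
  have hN0 : (0 : ℝ) ≤ N := Nat.cast_nonneg N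
  -- the exponent is at least `κ_N P`
  have hQ' : κN * P ≤ N * (2 * Real.pi * ((1 - t) * (γ * s) - a) ^ 2) / Es := by
    rw [le_div_iff₀ hEs, hid]
    have hlow : (1 - 2 * t) * (γ * s) ≤ (1 - t) * (γ * s) - a := by nlinarith
    have hlow0 : 0 ≤ (1 - 2 * t) * (γ * s) := mul_nonneg (by linarith) (mul_pos hγ hspos).le
    have hsq : ((1 - 2 * t) * (γ * s)) ^ 2 ≤ ((1 - t) * (γ * s) - a) ^ 2 := pow_le_pow_left₀ hlow0 hlow 2
    have h1 : 2 * Real.pi * (1 - 2 * t) ^ 2 * γ ^ 2 * s ^ 2 ≤ 2 * Real.pi * ((1 - t) * (γ * s) - a) ^ 2 := by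
      nlinarith [hsq, hπ]
    exact mul_le_mul_of_nonneg_left h1 hN0
  -- the prefactor is at least `2tγ`
  have hpre : 2 * t * γ ≤ t * (γ * s) / r := by
    rw [le_div_iff₀ hr0]
    have : t * γ * (2 * r) ≤ t * γ * s := mul_le_mul_of_nonneg_left (by linarith) (mul_pos ht hγ).le
    linarith
  have hexp1 : 2 * t * γ * Real.exp (κN * P) ≤ Real.exp (κ' * P) := by
    calc 2 * t * γ * Real.exp (κN * P)
        ≤ t * (γ * s) / r * Real.exp (N * (2 * Real.pi * ((1 - t) * (γ * s) - a) ^ 2) / Es) := by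
          gcongr
      _ ≤ Real.exp (κ' * P) := h
  -- hence `(κ_N − κ') P ≤ |log(2tγ)|`
  have htγ : 0 < 2 * t * γ := by positivity
  have hexp2 : Real.exp ((κN - κ') * P) ≤ (2 * t * γ)⁻¹ := by
    rw [sub_mul, Real.exp_sub, div_le_iff₀ (Real.exp_pos _), ← div_eq_inv_mul, le_div_iff₀ htγ]
    linarith
  have hlog : (κN - κ') * P ≤ |Real.log (2 * t * γ)| := by
    have h2 : Real.exp ((κN - κ') * P) ≤ Real.exp (Real.log (2 * t * γ)⁻¹) := by
      rw [Real.exp_log (inv_pos.2 htγ)]; exact hexp2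
    have h3 := Real.exp_le_exp.1 h2
    rw [Real.log_inv] at h3
    exact h3.trans (neg_le_abs _)
  have hbig : |Real.log (2 * t * γ)| < (κN - κ') * R := by
    have := (div_le_iff₀ hgap').1 (by linarith : |Real.log (2 * t * γ)| / (κN - κ') ≤ R - 1)
    nlinarith
  have hmono : (κN - κ') * R ≤ (κN - κ') * P := mul_le_mul_of_nonneg_left hP hgap'.le
  linarith

/-- **THEOREM P — THE PACKING MULTIPLIER** (nsreg-p2 ROUND-45 §3; the statement is `NsregP2.R45.PackingMultiplier` of
`r45/Sketch45.lean` VERBATIM).  Setting of THEOREM B′ with a fixed unit direction `e` and `1 < Λ' ≤ Λ`: `N ≥ 1`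
labels `‖yᵢ‖ < R` whose backward orbit segments `Ψ_t yᵢ`, `t ∈ [0,Lᵢ]`, stay in `B̄(0,ΛR)`, reach the cap
`⟪Ψ_{Lᵢ} yᵢ, e⟫ ≥ Λ'R`, and are `2r`-SEPARATED AT EQUAL HEIGHTS `≥ R`, for ANY disc radius `r ∈ [c₀R^{−(1+ρ)}, R/2]`:
then `‖DV(z)‖ ≥ exp(κ'R^{2+ρ})` somewhere on `B(0,(Λ+1)R)` for every
`κ' < N·κ_B(Λ,Λ') = N·2πγ²(Λ'³−1)/(3(Λ+1)^{1−ρ}C_E)` — THE EXPONENT IS MULTIPLIED BY THE NUMBER OF SEPARATED SEGMENTS.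
Proof: `exists_slice_packing_alternative_of_segments` (first hits + one quiet plane + one chart + t47-P₀) at the loss
parameter `t` of `exists_loss_parameter_packing`, then the margin arithmetic (`packing_amplitude_le` — here the lower
bound `c₀R^{−(1+ρ)}` on `r` is exactly what keeps the outer mean `√(2A/π)/r ≤ tγR` —, `sharp_drop_absurd`,
`packing_exp_absurd` with `R₁ = max(1, |log(2tγ)|/(Nκ₁−κ')+1)`). [nsreg-p2 ROUND-45 THEOREM P; folklore
(length–area method, additivity of capacity); cite: ConstantinIgnatovaVicol2026Putative, §3.4.1 for the setting] -/
theorem packingMultiplier :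
    ∀ (γ ρ C_A C_E Λ Λ' κ' : ℝ) (N : ℕ), 0 < γ → 0 ≤ ρ → 0 < C_A → 0 < C_E → 1 < Λ' → Λ' ≤ Λ → 1 ≤ N →
      κ' < N * (2 * Real.pi * γ ^ 2 * (Λ' ^ 3 - 1) / (3 * (Λ + 1) ^ (1 - ρ) * C_E)) →
      ∃ R₁ c₀ : ℝ, 0 < R₁ ∧ 0 < c₀ ∧
        ∀ (V : EuclideanSpace ℝ (Fin 3) → EuclideanSpace ℝ (Fin 3)) (K : ℝ), ContDiff ℝ 1 V →
          (∀ y, ‖fderiv ℝ V y‖ ≤ K) →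
          ∀ R r : ℝ, R₁ ≤ R → c₀ * R ^ (-(1 + ρ)) ≤ r → r ≤ R / 2 →
            (∫ x in ball (0 : EuclideanSpace ℝ (Fin 3)) ((Λ + 1) * R), ‖V x‖ ^ 2 ≤
                C_A * ((Λ + 1) * R) ^ (1 - 2 * ρ)) →
            (∫ x in ball (0 : EuclideanSpace ℝ (Fin 3)) ((Λ + 1) * R), ‖fderiv ℝ V x‖ ^ 2 ≤
                C_E * ((Λ + 1) * R) ^ (1 - ρ)) →
            ∀ (e : EuclideanSpace ℝ (Fin 3)), ‖e‖ = 1 →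
            ∀ (y : Fin N → EuclideanSpace ℝ (Fin 3)) (L : Fin N → ℝ), (∀ i, 0 ≤ L i) → (∀ i, ‖y i‖ < R) →
              (∀ i, ∀ t ∈ Icc 0 (L i),
                ‖ODE.evolutionMap (fun _ : ℝ => selfSimilarTransport γ 0 V) 0 (-t) (y i)‖ ≤ Λ * R) →
              (∀ i, Λ' * R ≤ ⟪ODE.evolutionMap (fun _ : ℝ => selfSimilarTransport γ 0 V) 0 (-(L i)) (y i), e⟫) →
              (∀ i j, i ≠ j → ∀ t ∈ Icc 0 (L i), ∀ t' ∈ Icc 0 (L j),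
                R ≤ ⟪ODE.evolutionMap (fun _ : ℝ => selfSimilarTransport γ 0 V) 0 (-t) (y i), e⟫ →
                ⟪ODE.evolutionMap (fun _ : ℝ => selfSimilarTransport γ 0 V) 0 (-t) (y i), e⟫ =
                  ⟪ODE.evolutionMap (fun _ : ℝ => selfSimilarTransport γ 0 V) 0 (-t') (y j), e⟫ →
                2 * r < ‖ODE.evolutionMap (fun _ : ℝ => selfSimilarTransport γ 0 V) 0 (-t) (y i) -
                  ODE.evolutionMap (fun _ : ℝ => selfSimilarTransport γ 0 V) 0 (-t') (y j)‖) →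
              ∃ z ∈ ball (0 : EuclideanSpace ℝ (Fin 3)) ((Λ + 1) * R),
                Real.exp (κ' * R ^ (2 + ρ)) ≤ ‖fderiv ℝ V z‖ := by
  intro γ ρ C_A C_E Λ Λ' κ' N hγ hρ hCA hCE hΛ' _ hN hκ
  have hπ : 0 < Real.pi := Real.pi_pos
  have hΛ1 : 0 < Λ + 1 := by linarith
  have hΛm : 0 < Λ' - 1 := by linarith
  -- the loss parameter and the raised packed coefficient `κ_N = N κ₁(t) > κ'`
  obtain ⟨t, ht0, ht4, hκN⟩ := exists_loss_parameter_packing (γ := γ) (ρ := ρ) (C_E := C_E) (Λ := Λ) (Λ' := Λ') hκ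
  have ht1 : t < 1 := by linarith
  have hμ : 1 < 1 + (1 - t) * (Λ' - 1) := by nlinarith
  have hμ3 : 0 < (1 + (1 - t) * (Λ' - 1)) ^ 3 - 1 := by
    nlinarith [pow_lt_pow_left₀ hμ zero_le_one three_ne_zero]
  obtain ⟨κN, hκNdef⟩ : ∃ κN : ℝ, κN = N * (2 * Real.pi * (1 - 2 * t) ^ 2 * γ ^ 2 *
      ((1 + (1 - t) * (Λ' - 1)) ^ 3 - 1) / (3 * C_E * (Λ + 1) ^ (1 - ρ))) := ⟨_, rfl⟩
  rw [← hκNdef] at hκN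
  have hgap : 0 < κN - κ' := sub_pos.2 hκN
  -- the disc-radius floor constant and the threshold radius
  obtain ⟨c₀, hc₀def⟩ : ∃ c₀ : ℝ,
      c₀ = Real.sqrt (2 * C_A * (Λ + 1) ^ (1 - 2 * ρ) / (Real.pi * t ^ 3 * γ ^ 2 * (Λ' - 1))) := ⟨_, rfl⟩
  have hL2 : 0 < (Λ + 1) ^ (1 - 2 * ρ) := Real.rpow_pos_of_pos hΛ1 _
  have hc₀ : 0 < c₀ := by rw [hc₀def]; exact Real.sqrt_pos.2 (by positivity)
  refine ⟨max 1 (|Real.log (2 * t * γ)| / (κN - κ') + 1), c₀, lt_max_of_lt_left one_pos, hc₀, ?_⟩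
  intro V K hV hK R r hR hc₀r hr2 hA hE e he y L hL hy hstay hcap hsep
  have h1 : 1 ≤ R := (le_max_left _ _).trans hR
  have hRb : |Real.log (2 * t * γ)| / (κN - κ') + 1 ≤ R := (le_max_right _ _).trans hR
  have hR0 : 0 < R := by linarith
  have hr0 : 0 < r := lt_of_lt_of_le (mul_pos hc₀ (Real.rpow_pos_of_pos hR0 _)) hc₀r
  have hX : 0 < C_A * ((Λ + 1) * R) ^ (1 - 2 * ρ) := mul_pos hCA (Real.rpow_pos_of_pos (by positivity) _)
  have hY : 0 < C_E * ((Λ + 1) * R) ^ (1 - ρ) := mul_pos hCE (Real.rpow_pos_of_pos (by positivity) _)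
  by_contra hcon
  push Not at hcon
  have hGm : ∀ z ∈ ball (0 : EuclideanSpace ℝ (Fin 3)) ((Λ + 1) * R),
      ‖fderiv ℝ V z‖ ≤ Real.exp (κ' * R ^ (2 + ρ)) := fun z hz => (hcon z hz).le
  obtain ⟨s, hs, halt⟩ := exists_slice_packing_alternative_of_segments hV hK he hN hγ hR0 hΛ' ht0 ht1 ht0 ht1
    hr0 hr2 hX hY hA hE hGm hL hy hstay hcap hsep
  have hsR : R ≤ s := hs.1
  have hm : 0 < γ * s := mul_pos hγ (hR0.trans_le hsR)
  -- the outer-mean term is `≤ tγR ≤ tγs`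
  have hc₀r' : Real.sqrt (2 * C_A * (Λ + 1) ^ (1 - 2 * ρ) / (Real.pi * t ^ 3 * γ ^ 2 * (Λ' - 1))) *
      R ^ (-(1 + ρ)) ≤ r := by rw [← hc₀def]; exact hc₀r
  have haR := packing_amplitude_le (ρ := ρ) (r := r) hCA hΛ1 hΛ' ht0 hγ hR0 hc₀r'
  have haS : Real.sqrt (2 * (C_A * ((Λ + 1) * R) ^ (1 - 2 * ρ) / (t * (Λ' - 1) * R)) / Real.pi) / r ≤
      t * (γ * s) := by
    have : t * γ * R ≤ t * γ * s := mul_le_mul_of_nonneg_left hsR (mul_pos ht0 hγ).le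
    linarith
  rcases halt with h | h
  · exact sharp_drop_absurd ht4 hm haS h
  · have hspos : 0 < s := hR0.trans_le hsR
    have hEs : 0 < 3 * (C_E * ((Λ + 1) * R) ^ (1 - ρ)) / (((1 + (1 - t) * (Λ' - 1)) ^ 3 - 1) * R ^ 3) * s ^ 2 :=
      mul_pos (div_pos (by positivity) (mul_pos hμ3 (by positivity))) (by positivity)
    have hP : R ≤ R ^ (2 + ρ) := by
      calc R = R ^ (1 : ℝ) := (Real.rpow_one R).symm
        _ ≤ R ^ (2 + ρ) := Real.rpow_le_rpow_of_exponent_le h1 (by linarith)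
    have hid : κN * R ^ (2 + ρ) *
        (3 * (C_E * ((Λ + 1) * R) ^ (1 - ρ)) / (((1 + (1 - t) * (Λ' - 1)) ^ 3 - 1) * R ^ 3) * s ^ 2) =
        N * (2 * Real.pi * (1 - 2 * t) ^ 2 * γ ^ 2 * s ^ 2) := by
      have h0 := sharpExponent_identity (γ := γ) (ρ := ρ) (t := t) (s := s) (μ := 1 + (1 - t) * (Λ' - 1))
        hCE hΛ1 hμ3 hR0
      rw [hκNdef, mul_assoc, mul_assoc, ← mul_assoc (2 * Real.pi * (1 - 2 * t) ^ 2 * γ ^ 2 *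
        ((1 + (1 - t) * (Λ' - 1)) ^ 3 - 1) / (3 * C_E * (Λ + 1) ^ (1 - ρ))), h0]
    exact packing_exp_absurd hκN ht0 ht4 hγ hR0 hsR hr0 hr2 haS hEs hP hid hRb h

end Summit.NavierStokesRegularity.NavierStokesRegularity.Theorems.PowerGaugeEulerLiouville.Condenser

end
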